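import Mathlib
import Literature.MathematicalPhysics.StatisticalMechanics.BarlowStackingEnergy
import Literature.MathematicalPhysics.StatisticalMechanics.Crystallization
import Literature.MathematicalPhysics.StatisticalMechanics.BarlowStacking
import Literature.MathematicalPhysics.StatisticalMechanics.HaggStacking

/-!
# Sketch — crux ideas for `TwelveWithinOne` (stmt-AtomisticToContinuum-15808), ideator 1, round 1

First lemmas of the two idea cards, typed over existing declarations (no proofs claimed).
-/

namespace Summit.AtomisticToContinuum.Crystallization.Cruxes.TwelveWithinOne.IdeatorOne

open scoped BigOperators
open Literature.MathematicalPhysics.StatisticalMechanics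

local notation "E3" => EuclideanSpace ℝ (Fin 3)

/-- `e*` : the infimum of the Lennard-Jones energy per particle over periodic configurations. -/
noncomputable def eStar : ℝ :=
  ⨅ Q : PeriodicConfiguration 3, Q.energyPerParticle lennardJones

/-- VERBATIM COPY of the crux `SquareWellLayerCake.TwelveWithinOne` (stmt-AtomisticToContinuum-15808), inlined so that this
workfile does not import the (re-rendered) route file; the seat's Sketch.lean (item evidence, rc 0) states the same compositions against
the route decls themselves. -/
def K2 : Prop :=
  ∀ x : (N : ℕ) → (Fin N → EuclideanSpace ℝ (Fin 3)), (∀ N, IsGroundState lennardJones (x N)) → Filter.Tendsto (fun N : ℕ => (Nat.card {i : Fin N // ¬ ((∀ j : Fin N, dist (x N i) (x N j) ≤ 11 / 10 → ∀ k : Fin N, k ≠ j → (55 : ℝ) / 57 ≤ dist (x N j) (x N k)) ∧ 12 ≤ (Finset.univ.filter fun j : Fin N => j ≠ i ∧ dist (x N i) (x N j) ≤ 1).card)} : ℝ) / N) Filter.atTop (nhds 0)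

/-- VERBATIM COPY of the route's support item `SquareWellLayerCake.LaminarBarlowWindows` (stmt-AtomisticToContinuum-14292). -/
def LBW : Prop :=
  ∀ R ε : ℝ, 0 < R → 0 < ε → ε < 1 / 4 → ∀ x : (N : ℕ) → (Fin N → EuclideanSpace ℝ (Fin 3)), (∀ N, IsGroundState lennardJones (x N)) → Filter.Tendsto (fun N : ℕ => (Nat.card {i : Fin N // ¬ (∃ a h : ℝ, 1 / 2 < a ∧ a < 2 ∧ 1 / 2 < h ∧ h < 2 ∧ ∃ s : ℤ → ℤ, IsHaggSeq s ∧ ∃ z ∈ barlowStacking a h s, ∃ A : EuclideanSpace ℝ (Fin 3) →ₗᵢ[ℝ] EuclideanSpace ℝ (Fin 3), (∀ p ∈ barlowStacking a h s, dist p z ≤ R → ∃ j : Fin N, dist (x N j) (x N i + A (p - z)) ≤ ε) ∧ (∀ j : Fin N, dist (x N j) (x N i) ≤ R → ∃ p ∈ barlowStacking a h s, dist (x N j) (x N i + A (p - z)) ≤ ε))} : ℝ) / N) Filter.atTop (nhds 0)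

/-- VERBATIM COPY of `PalmUnimodularRigidity.BenjaminiSchrammLimit` (stmt-AtomisticToContinuum-9230, PROVED in tree). -/
def BSL : Prop :=
  ∀ x : (N : ℕ) → (Fin N → EuclideanSpace ℝ (Fin 3)), (∀ N, IsGroundState lennardJones (x N)) → ∃ φ : ℕ → ℕ, StrictMono φ ∧ ∃ δ : ℝ, 0 < δ ∧ ∃ P : MeasureTheory.Measure (MeasureTheory.Measure (EuclideanSpace ℝ (Fin 3))), MeasureTheory.IsProbabilityMeasure P ∧ (∀ᵐ μ ∂P, (∃ S : Set (EuclideanSpace ℝ (Fin 3)), (0 : EuclideanSpace ℝ (Fin 3)) ∈ S ∧ (∀ x ∈ S, ∀ y ∈ S, x ≠ y → δ ≤ dist x y) ∧ μ = (MeasureTheory.Measure.count : MeasureTheory.Measure (EuclideanSpace ℝ (Fin 3))).restrict S)) ∧ (∀ g : MeasureTheory.Measure (EuclideanSpace ℝ (Fin 3)) → EuclideanSpace ℝ (Fin 3) → ENNReal, Measurable (Function.uncurry g) → ∫⁻ μ, ∫⁻ y, g μ y ∂μ ∂P = ∫⁻ μ, ∫⁻ y, g (MeasureTheory.Measure.map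 (fun z => z - y) μ) (-y) ∂μ ∂P) ∧ Filter.Tendsto (fun j : ℕ => groundStateEnergy lennardJones 3 (φ j) / (φ j : ℝ)) Filter.atTop (nhds (∫ μ, (∫ y, lennardJones ‖y‖ ∂μ) / 2 ∂P)) ∧ ∀ T : Set (MeasureTheory.Measure (EuclideanSpace ℝ (Fin 3))), ∀ R ε : ℝ, 0 < ε → ∀ ρ : ℝ, ρ < (P T).toReal → ∀ᶠ j : ℕ in Filter.atTop, ρ * (φ j : ℝ) ≤ (Nat.card {i : Fin (φ j) // ∃ ν ∈ T, ((∀ p : EuclideanSpace ℝ (Fin 3), ν {p} ≠ 0 → ‖p‖ ≤ R → ∃ q ∈ (Set.range (fun k : Fin (φ j) => x (φ j) k - x (φ j) i)), dist q p ≤ ε) ∧ (∀ q ∈ (Set.range (fun k : Fin (φ j) => x (φ j) k - x (φ j) i)), ‖q‖ ≤ R → ∃ p : EuclideanSpace ℝ (Fin 3), ν {p} ≠ 0 ∧ dist q p ≤ ε))} : ℝ)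

/-- VERBATIM COPY of `PalmUnimodularRigidity.CrysEnergyLimit` (stmt-AtomisticToContinuum-0626, PROVED in tree). -/
def CEL : Prop :=
  Filter.Tendsto (fun N : ℕ => groundStateEnergy lennardJones 3 N / N) Filter.atTop (nhds (⨅ Q : PeriodicConfiguration 3, Q.energyPerParticle lennardJones))

/-- CARD `barlow-cell-pinning`, first lemma (CELL PINNING, the K2-specific certified computation):
near-optimality of a Barlow template pins its cell into the K2 bond window. For every Hägg word `s`,
every layer `m` and every cell `(a, h) ∈ (1/2, 2)²`: if the site energy of the stacking is within `η₀`
of `e*`, then both nearest-neighbour bond lengths — the in-plane spacing `a` and the interlayer bond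
`√(a²/3 + h²)` — lie in `[0.9652, 0.978] ⊂ (55/57, 1)`. Numerics (folder compute/cell_pinning.py):
the sublevel set at `η = 5e-4` has bonds in `[0.9654, 0.9772]`, at `η = 1e-3` it already reaches
`0.9632 < 55/57 = 0.96491`; so `η₀ ≈ 5e-4` (the compression clause), while the coordination clause
alone (`bonds < 1`) survives up to `η ≈ 1e-2`. Stacking-blind: hcp and fcc ranges agree to `1e-4`. -/
def CellPinning : Prop :=
  ∃ η₀ : ℝ, 0 < η₀ ∧ ∀ (a h : ℝ), 1 / 2 < a → a < 2 → 1 / 2 < h → h < 2 →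
    ∀ s : ℤ → ℤ, IsHaggSeq s → ∀ m : ℤ,
      barlowSiteEnergy lennardJones a h s m ≤ eStar + η₀ →
        ((9652 : ℝ) / 10000 ≤ a ∧ a ≤ 978 / 1000 ∧
          (9652 : ℝ) / 10000 ≤ Real.sqrt (a ^ 2 / 3 + h ^ 2) ∧ Real.sqrt (a ^ 2 / 3 + h ^ 2) ≤ 978 / 1000)

/-- CARD `barlow-cell-pinning`, second statement (POINTWISE WINDOW OPTIMALITY by cut and paste):
in a Lennard-Jones ground state, EVERY window that is two-way `ε`-matched (after a linear isometry)
to a Barlow template on radius `R` has a near-optimal template: the template's site energies near the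
window centre are `≤ e* + η` once `R ≥ R₀(η)`, `ε ≤ ε₀(η)`. (Delete the window, paste a block of any
periodic `Q` far away, compare with `E(N)`; the tree's `windowOptimality_proof` is the one-`P`,
frequently-in-`N` version of the same surgery.) -/
def WindowTemplateOptimality : Prop :=
  ∀ η : ℝ, 0 < η → ∃ R₀ ε₀ : ℝ, 0 < R₀ ∧ 0 < ε₀ ∧ ∀ R ε : ℝ, R₀ ≤ R → 0 < ε → ε ≤ ε₀ →
    ∀ (N : ℕ) (x : Fin N → E3), IsGroundState lennardJones x → ∀ i : Fin N,
      ∀ (a h : ℝ), 1 / 2 < a → a < 2 → 1 / 2 < h → h < 2 → ∀ s : ℤ → ℤ, IsHaggSeq s →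
        ∀ z ∈ barlowStacking a h s, ∀ A : E3 →ₗᵢ[ℝ] E3,
          (∀ p ∈ barlowStacking a h s, dist p z ≤ R → ∃ j : Fin N, dist (x j) (x i + A (p - z)) ≤ ε) →
          (∀ j : Fin N, dist (x j) (x i) ≤ R → ∃ p ∈ barlowStacking a h s, dist (x j) (x i + A (p - z)) ≤ ε) →
            ∀ k i' j' : ℤ, dist (barlowPos a h s k i' j') z ≤ 1 →
              barlowSiteEnergy lennardJones a h s k ≤ eStar + η

/-- CARD `barlow-cell-pinning`, glue (FINE TEMPLATES IMPLY K2): if, for a ground-state sequence, all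
but `o(N)` particles have their radius-`3` window two-way `(1/10000)`-matched to a Barlow template
whose cell is pinned (`a`, `√(a²/3+h²) ∈ [0.9652, 0.978]`), then the `TwelveWithinOne` defect
fraction of that sequence tends to `0` (12 template neighbours at `≤ 0.978 + 2ε < 1`; all bonds
within `2.1` of the centre `≥ 0.9652 − 2ε ≥ 55/57`). Pure metric bookkeeping. -/
def FineTemplatesImplyK2 : Prop :=
  ∀ x : (N : ℕ) → (Fin N → E3), (∀ N, IsGroundState lennardJones (x N)) →
    Filter.Tendsto (fun N : ℕ => (Nat.card {i : Fin N // ¬ (∃ a h : ℝ,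
      (9652 : ℝ) / 10000 ≤ a ∧ a ≤ 978 / 1000 ∧
      (9652 : ℝ) / 10000 ≤ Real.sqrt (a ^ 2 / 3 + h ^ 2) ∧ Real.sqrt (a ^ 2 / 3 + h ^ 2) ≤ 978 / 1000 ∧
      ∃ s : ℤ → ℤ, IsHaggSeq s ∧ ∃ z ∈ barlowStacking a h s, ∃ A : E3 →ₗᵢ[ℝ] E3,
        (∀ p ∈ barlowStacking a h s, dist p z ≤ 3 → ∃ j : Fin N, dist (x N j) (x N i + A (p - z)) ≤ 1 / 10000) ∧
        (∀ j : Fin N, dist (x N j) (x N i) ≤ 3 → ∃ p ∈ barlowStacking a h s,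
          dist (x N j) (x N i + A (p - z)) ≤ 1 / 10000))} : ℝ) / N) Filter.atTop (nhds 0) →
    Filter.Tendsto (fun N : ℕ => (Nat.card {i : Fin N // ¬ ((∀ j : Fin N, dist (x N i) (x N j) ≤ 11 / 10 →
      ∀ k : Fin N, k ≠ j → (55 : ℝ) / 57 ≤ dist (x N j) (x N k)) ∧
      12 ≤ (Finset.univ.filter fun j : Fin N => j ≠ i ∧ dist (x N i) (x N j) ≤ 1).card)} : ℝ) / N)
      Filter.atTop (nhds 0)

/-- The card's composition claim, as a Prop (not proved here): Barlow windows a.e. (the route's own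
support item `LaminarBarlowWindows`, stmt-14292 = X of route LaminarSixThreeThree) together with
pointwise window optimality, cell pinning and the metric glue give the crux. -/
def CardA_Composition : Prop :=
  LBW → WindowTemplateOptimality → CellPinning → FineTemplatesImplyK2 → K2

/-- CARD `selection-free-palm-window`, first lemma = the TRANSFER TARGET (measure-level K2, with the
crux's thresholds made strict/open, which the relaxed polytypes satisfy with margins 0.6 % / 2.9 %):
for every hard core `δ > 0` and every point-stationary probability law `P` on rooted `δ`-separated
configurations with `E_P[h] ≤ e*` (hypotheses copied verbatim from `PalmUnimodularRigidity.MinimiserShells`),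
`P`-a.s. the root has at least twelve configuration points in the OPEN unit ball and every configuration
point within `11/10` of the root has all its other distances `> 55/57`. -/
def PalmTwelveWithinOne : Prop :=
  ∀ δ : ℝ, 0 < δ → ∀ P : MeasureTheory.Measure (MeasureTheory.Measure E3),
    MeasureTheory.IsProbabilityMeasure P →
    (∀ᵐ μ ∂P, (∃ S : Set E3, (0 : E3) ∈ S ∧ (∀ x ∈ S, ∀ y ∈ S, x ≠ y → δ ≤ dist x y) ∧
      μ = (MeasureTheory.Measure.count : MeasureTheory.Measure E3).restrict S)) →
    (∀ g : MeasureTheory.Measure E3 → E3 → ENNReal, Measurable (Function.uncurry g) →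
      ∫⁻ μ, ∫⁻ y, g μ y ∂μ ∂P = ∫⁻ μ, ∫⁻ y, g (MeasureTheory.Measure.map (fun z => z - y) μ) (-y) ∂μ ∂P) →
    (∫ μ, (∫ y, lennardJones ‖y‖ ∂μ) / 2 ∂P) ≤ eStar →
    ∀ᵐ μ ∂P, (12 ≤ Set.encard {y : E3 | μ {y} ≠ 0 ∧ y ≠ 0 ∧ ‖y‖ < 1}) ∧
      (∀ y : E3, μ {y} ≠ 0 → ‖y‖ ≤ 11 / 10 → ∀ w : E3, μ {w} ≠ 0 → w ≠ y → (55 : ℝ) / 57 < dist y w)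

/-- CARD `selection-free-palm-window`, the transfer target WITH MARGINS (the form the proved density transfer
`PalmUnimodularRigidity.BenjaminiSchrammLimit` consumes directly): for every minimising point-stationary hard-core law,
a.s. the root has at least twelve configuration points within distance `99/100` and every configuration point within
`6/5` of the root is `968/1000`-separated from all other points. Implied by "a.s. an exact layer-relaxed stacking of its
own word" (bonds in `[0.970, 0.9725]`); implies `PalmTwelveWithinOne`. -/
def PalmBondWindow : Prop :=
  ∀ δ : ℝ, 0 < δ → ∀ P : MeasureTheory.Measure (MeasureTheory.Measure E3),
    MeasureTheory.IsProbabilityMeasure P →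
    (∀ᵐ μ ∂P, (∃ S : Set E3, (0 : E3) ∈ S ∧ (∀ x ∈ S, ∀ y ∈ S, x ≠ y → δ ≤ dist x y) ∧
      μ = (MeasureTheory.Measure.count : MeasureTheory.Measure E3).restrict S)) →
    (∀ g : MeasureTheory.Measure E3 → E3 → ENNReal, Measurable (Function.uncurry g) →
      ∫⁻ μ, ∫⁻ y, g μ y ∂μ ∂P = ∫⁻ μ, ∫⁻ y, g (MeasureTheory.Measure.map (fun z => z - y) μ) (-y) ∂μ ∂P) →
    (∫ μ, (∫ y, lennardJones ‖y‖ ∂μ) / 2 ∂P) ≤ eStar →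
    ∀ᵐ μ ∂P, (12 ≤ Set.encard {y : E3 | μ {y} ≠ 0 ∧ y ≠ 0 ∧ ‖y‖ ≤ 99 / 100}) ∧
      (∀ y : E3, μ {y} ≠ 0 → ‖y‖ ≤ 6 / 5 → ∀ w : E3, μ {w} ≠ 0 → w ≠ y → (968 : ℝ) / 1000 ≤ dist y w)

/-- CARD `selection-free-palm-window`, the finite-N transfer (M-sized, by contradiction along a bad subsequence):
the margin form at the measure level, the PROVED Benjamini–Schramm density transfer (item 9230) and the PROVED energy
limit (item 0626) give the crux. -/
def PalmTransferK2 : Prop :=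
  PalmBondWindow → BSL → CEL → K2

/-- CARD `selection-free-palm-window`, the stacking-blind SCALE WINDOW in its coarse form (all that the
measure-level line needs, because there the configuration is a.s. an EXACT relaxed stacking): for every
cell `(a, h)` at which the site energy of layer `m` of the word `s` is MINIMAL over `(a, h)` (uniform layer spacing;
the layer-wise relaxed family of card own-word-squeeze differs by ≲ 1e-4), both bond lengths lie in `[0.970, 0.9725]`.
Typed as: minimality in `(a, h)` at fixed word and layer implies the window. -/
def OwnWordScaleWindow : Prop :=
  ∀ s : ℤ → ℤ, IsHaggSeq s → ∀ m : ℤ, ∀ (a h : ℝ), 1 / 2 < a → a < 2 → 1 / 2 < h → h < 2 →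
    (∀ a' h' : ℝ, 1 / 2 < a' → a' < 2 → 1 / 2 < h' → h' < 2 →
      barlowSiteEnergy lennardJones a h s m ≤ barlowSiteEnergy lennardJones a' h' s m) →
    ((970 : ℝ) / 1000 ≤ a ∧ a ≤ 9725 / 10000 ∧
      (970 : ℝ) / 1000 ≤ Real.sqrt (a ^ 2 / 3 + h ^ 2) ∧ Real.sqrt (a ^ 2 / 3 + h ^ 2) ≤ 9725 / 10000)

/-- CARD `fracture-is-free-zero-pressure`, first lemma (MESOSCOPIC NO-TENSION, provable now): in a Lennard-Jones ground state
no ball carries net tension at scale beyond `R^{5/2}`: contracting the particles of `B(c, R)` by `1 − δ`, `δ ~ R^{-1/2}`, about `c`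
opens a gap `δ R` to the outside (fracture costs only the cross binding `≤ C₁ R²`), gains `δ ·` (virial of the ball) to first order and
loses `≤ 7 δ² k₁₂ |B|` to second order; minimality over `N`-point configurations then bounds the ball's virial
`Σ_{pairs in B} r V′(r) = Σ (r⁻⁶ − r⁻¹²)` by `C R^{5/2}`. With the exact global virial `Σ_{all pairs} (r⁻⁶ − r⁻¹²) = 0` of a ground state
this gives zero pressure in all but a vanishing fraction of mesoscopic cubes. -/
def MesoscopicNoTension : Prop :=
  ∃ C : ℝ, ∀ (N : ℕ) (x : Fin N → E3), IsGroundState lennardJones x →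
    ∀ (c : E3) (R : ℝ), 1 ≤ R →
      (∑ i : Fin N, ∑ j ∈ Finset.Ioi i,
        (if dist (x i) c ≤ R ∧ dist (x j) c ≤ R then
          ((dist (x i) (x j))⁻¹ ^ 6 - (dist (x i) (x j))⁻¹ ^ 12) else 0)) ≤ C * R ^ (5 / 2 : ℝ)

/-- CARD `fracture-is-free-zero-pressure`, second statement (ZERO-PRESSURE CELL WINDOW, coarse certificate): on the part of the
zero-pressure curve of the Barlow landscape that is `η₁`-optimal, the cell is inside the K2 box; numerically (compute/zp_curve2.py)
bonds `≤ 55/57` first occur at excess `1.6e-3` along the curve (vs `5e-4 … 1e-3` off it) and bonds `≥ 1` first at excess `1.55e-2`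
(vs `1.0e-2`), so for the COORDINATION clause the tree's certified `eStar ≤ −0.711` (excess `6.6e-3`) already suffices. Virial per
site of the template: `Σ (r⁻⁶ − r⁻¹²)/2` over the stacking, written with the same layer sums as `barlowSiteEnergy` for the potential
`r ↦ (r⁻⁶ − r⁻¹²)/… `; here we only TYPE the window statement with an abstract tolerance `τ` on that virial. -/
def ZeroPressureCellWindow : Prop :=
  ∃ η₁ τ : ℝ, 0 < η₁ ∧ 0 < τ ∧ ∀ (a h : ℝ), 1 / 2 < a → a < 2 → 1 / 2 < h → h < 2 →
    ∀ s : ℤ → ℤ, IsHaggSeq s → ∀ m : ℤ,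
      barlowSiteEnergy lennardJones a h s m ≤ eStar + η₁ →
      |barlowSiteEnergy (fun r : ℝ => r⁻¹ ^ 6 - r⁻¹ ^ 12) a h s m| ≤ τ →
        ((9652 : ℝ) / 10000 ≤ a ∧ a ≤ 978 / 1000 ∧
          (9652 : ℝ) / 10000 ≤ Real.sqrt (a ^ 2 / 3 + h ^ 2) ∧ Real.sqrt (a ^ 2 / 3 + h ^ 2) ≤ 978 / 1000)

end Summit.AtomisticToContinuum.Crystallization.Cruxes.TwelveWithinOne.IdeatorOne
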